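import Literature.MathematicalPhysics.QuantumFieldTheory.Balaban1983to89.B15Prop1RealChartFamilyFromMinimiserChart
import Literature.Analysis.Complex.CauchyTaylorBall

/-!
# `Balaban1983to89.B15Prop1RealChartFamilyExplicit` — [Balaban1985Variational] = «[15]», (15) p. 280 («`U = U′U₀`»), Sect. G (172) p. 305, Prop. 9 (190) p. 309;
# [Balaban1988Convergent] = «[III]», (2.12)–(2.14) pp. 256–257; [Balaban1989LargeFieldI] = «[IV]», Prop. 1 p. 194 (last clause); [Balaban1989LargeFieldII] = «[LF-II]»,
# (1.12) p. 359, (1.19) p. 360; [HormanderSCV1973] Thm 2.2.7 (Cauchy's inequalities):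
# ★★ THE (K′) FAMILY WITH ITS WITNESS DISPLAYED, AND THE TWO PIECES OF BOOKKEEPING ITS VELOCITY LETTER (K) NEEDS — CAUCHY's INEQUALITY ALONG COMPLEX LINES AND
# THE ENTRY BOUND FOR THE LINEAR PART OF THE LOGARITHMIC COORDINATES

Honest framing: statement-level skeleton of published theorems with citation tags; proofs where landed; nothing here is a claim about the
Yang–Mills mass gap.  Cell `pub-ymgap`, HUMAN RULING D-0154 (R399 (3a) width seats), seat `pub-ymgap-dag-n12-w5` (g2; N12 = [B15]; self-located on the lane owner's
letter list, bus l.30272: «package (N) per (i,V_k) ← … + (K) + …», CLAIM-1 l.30330); count-neutral helper of K1⁷ (`stmt-QuantumFields-20542`); N12 NOT discharged; finite 𝕋⁴ at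
fixed ε; nothing continuum ∕ OS ∕ mass-gap ∕ Clay.

WHY.  The assembled endpoint of the N12∕s1 lane (`B15Prop1EndpointNearFlatLetters`, p610003) carries, per instance and base field, the letter package (N) about ONE pair
`(U₀, X_f)`: the (K′) clauses (`X_f 0 = 0`, `C²` at `0`, minimisers `expChart U₀ (X_f Y)` near `0`) — produced, behind an `∃`, by
`B15Prop1RealChartFamilyFromMinimiserChart.exists_realChartFamily_of_minimiserChart` (p608072) — AND the velocity letter (K) `p (fderiv ℝ X_f 0 X) ≤ K_c‖X‖` about THE SAME `X_f`.
Since the family is existentially packaged, (K) can only be discharged by its producer.  THIS MODULE therefore (i) re-states the (K′) construction with its witness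
DISPLAYED — `X_f Y (b) := φ(Re logCoordC(U₀(b)⋆ · Ũ(0, ι ιA Y)(b)))` for ANY `U₀` with `Ũ(0,0) = U₀` bondwise (`realChartFamily_explicit`; proof = p608072's, verbatim) —, and
(ii) supplies the two generic inequalities the velocity bound of the sibling module `B15Prop1RealChartFamilyVelocity` rests on: Cauchy's inequality along complex lines through the
origin of a ball in several complex variables (`‖Df(0) v‖ ≤ 2M‖v‖∕R` from `‖f‖ ≤ M` on `ball 0 R`; the tree's one-variable `Literature.Analysis.Complex.norm_deriv_le_of_forall_mem_ball`
on the line `t ↦ t•v`) — how [15] Prop. 9 (190)'s analyticity in `V′` yields derivative bounds —, and the entry bound `|tr(E_a U⋆ N)| ≤ Σ_{ij} |N_ij|` for unitary `U` (the generators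
`E_a` of the chart (1.19) are unitary, so `E_a U⋆` has entries of modulus `≤ 1`), which controls the linear part `T = D logCoordC(1)`, `T(M)_a = −½ tr(E_a M)`, of the logarithmic
coordinates entry by entry.

CONTENTS (theorems only; no `def`, no `instance`, no `sorry`).
* §1 ★ `norm_fderiv_apply_le_of_forall_mem_ball` — directional Cauchy estimate in several complex variables [folklore].
* §2 `genE_mul_self` (`E_a² = −1`), `genE_mem_unitaryGroup`, `norm_genE_mul_star_apply_le_one`, ★ `norm_trace_genE_mul_star_mul_le`, `norm_euclidean_three_le_two_mul` (ℝ³ bookkeeping).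
* §3 `exists_reCoordCLM` (coordinatewise real part `ℂ³ → ℝ³` as a continuous ℝ-linear map, existence), `cplxVec_pair_zero`, ★★ `realChartFamily_explicit` — (K′)'s three clauses for the
  explicit family with the base minimiser `U₀` as INPUT.
HONEST SCOPE: finite-dimensional calculus and `2×2` matrix bookkeeping on the tree's objects; (J0′) (the holomorphic minimiser chart `Ũ`, [15] Prop. 9 (190)) stays a HYPOTHESIS; nothing
of Bałaban's estimates is asserted; N12 NOT discharged; K1⁷ NOT closed.
-/

noncomputable section

open Set Metric Filter
open scoped Topology ContDiff Matrix.Norms.L2Operator ComplexConjugate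

namespace Literature.MathematicalPhysics.QuantumFieldTheory.Balaban1983to89.B15Prop1RealChartFamilyExplicit

open B15SU2ChartHolomorphic (genE logCoordC genE_zero_eq genE_one_eq genE_two_eq star_genE)

/-! ## §1  Cauchy's inequality along complex lines -/

section Cauchy

variable {E F : Type*} [NormedAddCommGroup E] [NormedSpace ℂ E] [NormedAddCommGroup F] [NormedSpace ℂ F] [CompleteSpace F]

/-- ★ **CAUCHY's INEQUALITY ALONG COMPLEX LINES (several complex variables, directional form).**  If `f : E → F` is ℂ-differentiable on `ball 0 R` of a complex normed space `E`
(values in a complete space) and `‖f z‖ ≤ M` there, then `‖Df(0) v‖ ≤ (2M∕R)·‖v‖` for every direction `v`: restrict to the complex line `t ↦ t • v`, holomorphic on `|t| < R∕‖v‖`,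
and apply the one-variable estimate `Literature.Analysis.Complex.norm_deriv_le_of_forall_mem_ball` (`‖g′(0)‖ ≤ 2M∕ρ`).  This is how analyticity of the minimiser in the datum ([15] Prop. 9
(190)) prices its first derivative. [cite: HormanderSCV1973, Thm 2.2.7; Balaban1985Variational, Prop. 9 (190) p.309] -/
theorem norm_fderiv_apply_le_of_forall_mem_ball {f : E → F} {R M : ℝ} (hR : 0 < R)
    (hf : DifferentiableOn ℂ f (ball 0 R)) (hM : ∀ z ∈ ball (0 : E) R, ‖f z‖ ≤ M) (v : E) :
    ‖fderiv ℂ f 0 v‖ ≤ 2 * M / R * ‖v‖ := by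
  have hM0 : 0 ≤ M := (norm_nonneg _).trans (hM 0 (mem_ball_self hR))
  by_cases hv : v = 0
  · rw [hv, map_zero, norm_zero, norm_zero, mul_zero]
  have hvpos : 0 < ‖v‖ := norm_pos_iff.2 hv
  -- the complex line through `0` in the direction `v`
  set ρ : ℝ := R / ‖v‖ with hρ
  have hρpos : 0 < ρ := div_pos hR hvpos
  have hline : ∀ t : ℂ, t ∈ ball (0 : ℂ) ρ → t • v ∈ ball (0 : E) R := fun t ht => by
    rw [mem_ball_zero_iff] at ht ⊢
    rw [norm_smul]
    calc ‖t‖ * ‖v‖ < ρ * ‖v‖ := mul_lt_mul_of_pos_right ht hvpos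
      _ = R := by rw [hρ, div_mul_cancel₀ R hvpos.ne']
  have hsmul : Differentiable ℂ (fun t : ℂ => t • v) := fun t => (differentiableAt_id.smul_const v)
  have hg : DifferentiableOn ℂ (fun t : ℂ => f (t • v)) (ball 0 ρ) :=
    hf.comp hsmul.differentiableOn fun t ht => hline t ht
  have hgM : ∀ t ∈ ball (0 : ℂ) ρ, ‖f (t • v)‖ ≤ M := fun t ht => hM _ (hline t ht)
  have hderiv : deriv (fun t : ℂ => f (t • v)) 0 = fderiv ℂ f 0 v := by
    have hf0' : DifferentiableAt ℂ f 0 := hf.differentiableAt (isOpen_ball.mem_nhds (mem_ball_self hR))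
    have hf0 : DifferentiableAt ℂ f ((fun t : ℂ => t • v) 0) := by
      simp only [zero_smul]
      exact hf0'
    have hl : HasDerivAt (fun t : ℂ => t • v) v 0 := by
      simpa using (hasDerivAt_id (0 : ℂ)).smul_const v
    have h := hf0.hasFDerivAt.comp_hasDerivAt (0 : ℂ) hl
    simp only [zero_smul] at h
    exact h.deriv
  have h := Literature.Analysis.Complex.norm_deriv_le_of_forall_mem_ball hρpos hg hgM
  rw [hderiv] at h
  calc ‖fderiv ℂ f 0 v‖ ≤ 2 * M / ρ := h
    _ = 2 * M / R * ‖v‖ := by rw [hρ]; field_simp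

end Cauchy

/-! ## §2  `𝔰𝔲(2)` bookkeeping: the generators are unitary; the linear part of the logarithmic coordinates is bounded by the entries -/

section Algebra

/-- **`E_a² = −1`** for the three generators `E_a = quatMatrix(ι e_a)` of the chart (1.19) (`iσ₃, iσ₂′, iσ₁`-type matrices). [cite: Balaban1989LargeFieldII, (1.19) p.360 (bookkeeping); Balaban1985Averaging, (21) p.21] -/
theorem genE_mul_self (a : Fin 3) : genE a * genE a = -1 := by
  fin_cases a
  · show genE 0 * genE 0 = -1
    rw [genE_zero_eq]
    ext i j
    fin_cases i <;> fin_cases j <;> simp [Matrix.mul_apply, Fin.sum_univ_two]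
  · show genE 1 * genE 1 = -1
    rw [genE_one_eq]
    ext i j
    fin_cases i <;> fin_cases j <;> simp [Matrix.mul_apply, Fin.sum_univ_two]
  · show genE 2 * genE 2 = -1
    rw [genE_two_eq]
    ext i j
    fin_cases i <;> fin_cases j <;> simp [Matrix.mul_apply, Fin.sum_univ_two]

/-- **THE GENERATORS ARE UNITARY**: `E_a ∈ U(2)` (`E_a⋆ = −E_a`, `E_a² = −1`). [cite: Balaban1989LargeFieldII, (1.19) p.360 (bookkeeping)] -/
theorem genE_mem_unitaryGroup (a : Fin 3) : genE a ∈ Matrix.unitaryGroup (Fin 2) ℂ := by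
  rw [Matrix.mem_unitaryGroup_iff, star_genE, Matrix.mul_neg, genE_mul_self, neg_neg]

/-- The entries of `E_a · U⋆` have modulus `≤ 1` for `U` unitary (a unitary matrix has entries of modulus `≤ 1`, Mathlib's `entry_norm_bound_of_unitary`). [cite: Balaban1989LargeFieldII, (1.19) p.360 (bookkeeping)] -/
theorem norm_genE_mul_star_apply_le_one {U : Matrix (Fin 2) (Fin 2) ℂ} (hU : U ∈ Matrix.unitaryGroup (Fin 2) ℂ)
    (a : Fin 3) (i j : Fin 2) : ‖(genE a * star U) i j‖ ≤ 1 :=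
  entry_norm_bound_of_unitary (Submonoid.mul_mem _ (genE_mem_unitaryGroup a) (Unitary.star_mem hU)) i j

/-- ★ **THE ENTRY BOUND FOR THE LINEAR PART OF THE LOGARITHMIC COORDINATES**: `|tr(E_a · U⋆ · N)| ≤ Σ_{i,j} |N_{ij}|` for `U` unitary and any `N ∈ M₂(ℂ)` — so the coordinate
`T(U⋆N)_a = −½ tr(E_a U⋆ N)` of `D logCoordC(1)` is at most half the `ℓ¹` size of the entries of `N`. [cite: Balaban1985Averaging, (21) p.21; Balaban1989LargeFieldII, (1.19) p.360] -/
theorem norm_trace_genE_mul_star_mul_le {U : Matrix (Fin 2) (Fin 2) ℂ} (hU : U ∈ Matrix.unitaryGroup (Fin 2) ℂ)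
    (a : Fin 3) (N : Matrix (Fin 2) (Fin 2) ℂ) :
    ‖(genE a * (star U * N)).trace‖ ≤ ∑ i, ∑ j, ‖N i j‖ := by
  rw [← Matrix.mul_assoc]
  have htr : (genE a * star U * N).trace = ∑ i, ∑ j, (genE a * star U) i j * N j i := by
    simp only [Matrix.trace, Matrix.diag, Matrix.mul_apply]
  rw [htr]
  calc ‖∑ i, ∑ j, (genE a * star U) i j * N j i‖
      ≤ ∑ i, ‖∑ j, (genE a * star U) i j * N j i‖ := norm_sum_le _ _
    _ ≤ ∑ i, ∑ j, ‖(genE a * star U) i j * N j i‖ := Finset.sum_le_sum fun i _ => norm_sum_le _ _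
    _ ≤ ∑ i, ∑ j, ‖N j i‖ := by
        refine Finset.sum_le_sum fun i _ => Finset.sum_le_sum fun j _ => ?_
        rw [norm_mul]
        calc ‖(genE a * star U) i j‖ * ‖N j i‖ ≤ 1 * ‖N j i‖ :=
              mul_le_mul_of_nonneg_right (norm_genE_mul_star_apply_le_one hU a i j) (norm_nonneg _)
          _ = ‖N j i‖ := one_mul _
    _ = ∑ i, ∑ j, ‖N i j‖ := by
        rw [Finset.sum_comm]

/-- A vector of `ℝ³` with coordinates of modulus `≤ m` has Euclidean norm `≤ 2m` (`√3 ≤ 2`; bookkeeping for the size of `φ(y)`). [cite: Balaban1985Averaging, (19) p.21 (bookkeeping)] -/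
theorem norm_euclidean_three_le_two_mul {m : ℝ} (y : EuclideanSpace ℝ (Fin 3)) (hy : ∀ a, ‖y a‖ ≤ m) : ‖y‖ ≤ 2 * m := by
  have hm : 0 ≤ m := (norm_nonneg _).trans (hy 0)
  have hsq : ‖y‖ ^ 2 ≤ (2 * m) ^ 2 := by
    rw [EuclideanSpace.norm_sq_eq]
    calc ∑ a, ‖y a‖ ^ 2 ≤ ∑ _a : Fin 3, m ^ 2 := Finset.sum_le_sum fun a _ => by
            have := hy a
            exact pow_le_pow_left₀ (norm_nonneg _) this 2
      _ = 3 * m ^ 2 := by simp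
      _ ≤ (2 * m) ^ 2 := by nlinarith
  exact (pow_le_pow_iff_left₀ (norm_nonneg _) (by positivity) two_ne_zero).1 hsq

end Algebra

/-! ## §3  The explicit (K′) family with the base minimiser as input -/

section Explicit

open B15Prop1SliceCoordinates (GaugeSlice ιA norm_ιA_apply_le)
open B15Prop1SliceTaylorCalculus (ιAc cplxSliceL cplxSliceL_apply ιAc_cplxSlice)
open B15Prop1ChartCalculusSU2 (E3)
open T4CubeChartGnomonic (SU2)
open T4Continuum B15DeterminingSets GaugeField
open T4AdjointCovarianceUnitary (lieSU)
open Node00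
open B16Sect1Backgrounds (expMul expMul_zero)
open B15Prop1AnalyticExtClause (cplxVec norm_cplxVec)
open B15Prop1ChartSU2 (su2Chart)
open Literature.MathematicalPhysics.QuantumLattice (quatMatrix)
open T4HaarSU2ExpChart (imQuat norm_imQuat)
open T4QuatExpLog (norm_quatMatrix)
open B15Prop1RealChartFamilyFromMinimiserChart (contDiffOn_matrix_of_entries contDiffAt_logCoordC contDiff_reVec logCoordC_one
  coe_mul_exp_logChart_eq)
open Literature.MathematicalPhysics.QuantumFieldTheory.BalabanImbrieJaffe1984to88.BIJ85Eq453GaugeField (qsstarGIter0)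

variable {P : Params} {k : ℕ} [DecidableEq (PBond P k)]

/-- **THE COORDINATEWISE REAL PART `ℂ³ → ℝ³` AS A CONTINUOUS ℝ-LINEAR MAP** (existence; no new definition). [cite: Balaban1989LargeFieldI, Prop. 1 p.194 («B′ ∈ 𝔤ᶜ» ⊃ real `B′ ∈ 𝔤`, bookkeeping)] -/
theorem exists_reCoordCLM : ∃ Rc : EuclideanSpace ℂ (Fin 3) →L[ℝ] EuclideanSpace ℝ (Fin 3), ∀ z a, Rc z a = (z a).re := by
  let e : EuclideanSpace ℝ (Fin 3) ≃L[ℝ] (Fin 3 → ℝ) := PiLp.continuousLinearEquiv 2 ℝ (fun _ : Fin 3 => ℝ)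
  let Rpi : EuclideanSpace ℂ (Fin 3) →L[ℝ] (Fin 3 → ℝ) := ContinuousLinearMap.pi fun a =>
    Complex.reCLM.comp ((EuclideanSpace.proj a : EuclideanSpace ℂ (Fin 3) →L[ℂ] ℂ).restrictScalars ℝ)
  exact ⟨(e.symm : (Fin 3 → ℝ) →L[ℝ] EuclideanSpace ℝ (Fin 3)).comp Rpi, fun z a => rfl⟩

/-- The complexified zero field and the complexified slice coordinate of `0` give the origin of the chart parameters. [cite: Balaban1989LargeFieldI, Prop. 1 p.194 (bookkeeping)] -/
theorem cplxVec_pair_zero (S : Set (Site P k)) (T : Finset (PBond P k)) :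
    ((cplxVec (0 : VecField P k E3), cplxVec (ιA S T (0 : GaugeSlice S T E3))) :
      VecField P k (EuclideanSpace ℂ (Fin 3)) × VecField P k (EuclideanSpace ℂ (Fin 3))) = 0 := by
  have hcv0 : cplxVec (0 : VecField P k E3) = 0 := by
    funext b; ext i; simp [cplxVec]
  rw [map_zero, hcv0]
  rfl

/-- ★★ **(K′) EXPLICIT — THE THREE CLAUSES OF THE REAL CHART FAMILY WITH THE BASE MINIMISER AS INPUT.**  For the chart `Ũ` of (J0′) (entrywise ℂ-differentiable on
`ball 0 R`, real points = matrix fields of (2.12) minimisers) and ANY `U₀` with `Ũ(0,0) = U₀` bondwise, the explicit family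
`X_f Y (b) := φ(Re logCoordC(U₀(b)⋆ · Ũ(0, ι ιA Y)(b)))` has `X_f 0 = 0`, is `C²` at `0`, and `expChart U₀ (X_f Y)` is a (2.12) minimiser of the rotated datum for all `Y` near `0` —
the construction of `B15Prop1RealChartFamilyFromMinimiserChart.exists_realChartFamily_of_minimiserChart` (p608072) with its witness DISPLAYED, so that further letters about
the SAME family (its velocity, §3–§4) can be stated. [cite: Balaban1985Variational, (15) p.280, Prop. 9 (190) p.309; Balaban1988Convergent, (2.12)–(2.14) pp.256–257; Balaban1989LargeFieldI, Prop. 1 p.194 (last clause); Balaban1989LargeFieldII, p.359, (1.12) p.359; HormanderSCV1973, Thm 2.2.1] -/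
theorem realChartFamily_explicit (S : Set (Site P k)) (T : Finset (PBond P k))
    (φ : EuclideanSpace ℝ (Fin 3) →ₗ[ℝ] lieSU (Fin 2)) (hφ : ∀ v, ((φ v : lieSU (Fin 2)) : Matrix (Fin 2) (Fin 2) ℂ) = quatMatrix (imQuat v))
    (av : ∀ j, Averaging P j SU2) (reg : Set (GaugeField P 0 SU2)) (𝔹 : DetSet P)
    (ext : GaugeField P k SU2 → GaugeField P k SU2) (Vk : GaugeField P k SU2) {R : ℝ} (hR : 0 < R)
    (Ũ : VecField P k (EuclideanSpace ℂ (Fin 3)) × VecField P k (EuclideanSpace ℂ (Fin 3)) → PBond P 0 → Matrix (Fin 2) (Fin 2) ℂ)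
    (hdiff : ∀ b a c, DifferentiableOn ℂ (fun z => Ũ z b a c) (ball 0 R))
    (hreal : ∀ p B' : VecField P k E3, ‖p‖ < R → ‖B'‖ < R → ∃ U' : GaugeField P 0 SU2,
      (∀ b, Ũ (cplxVec p, cplxVec B') b = ((U' b : SU2) : Matrix (Fin 2) (Fin 2) ℂ)) ∧
        IsMinimizer av reg 𝔹 (avgFamily av (qsstarGIter0 k (expMul su2Chart B' (ext (expMul su2Chart p Vk))))) U')
    (U₀ : GaugeField P 0 SU2) (hU₀eq : ∀ b, Ũ (cplxVec (0 : VecField P k E3), cplxVec (0 : VecField P k E3)) b = ((U₀ b : SU2) : Matrix (Fin 2) (Fin 2) ℂ))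
    (Xf : GaugeSlice S T E3 → PBond P 0 → lieSU (Fin 2))
    (hXf : Xf = fun Y b => φ (WithLp.toLp 2 fun a =>
      (logCoordC (star ((U₀ b : SU2) : Matrix (Fin 2) (Fin 2) ℂ) * Ũ (cplxVec (0 : VecField P k E3), cplxVec (ιA S T Y)) b) a).re)) :
    Xf 0 = 0 ∧ ContDiffAt ℝ 2 Xf 0 ∧
      ∀ᶠ Y in 𝓝 (0 : GaugeSlice S T E3),
        IsMinimizer av reg 𝔹 (avgFamily av (qsstarGIter0 k (expMul su2Chart (ιA S T Y) (ext Vk)))) (expChart U₀ (Xf Y)) := by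
  have h0R : ‖(0 : VecField P k E3)‖ < R := by simpa using hR
  -- the ℝ-affine parameter map of the slice into the complexified chart parameters
  set g : GaugeSlice S T E3 → VecField P k (EuclideanSpace ℂ (Fin 3)) × VecField P k (EuclideanSpace ℂ (Fin 3)) :=
    fun Y => (cplxVec (0 : VecField P k E3), cplxVec (ιA S T Y)) with hgdef
  have hg0 : g 0 = 0 := cplxVec_pair_zero S T
  have hg2 : ContDiff ℝ ((2 : ℕ) : WithTop ℕ∞) (fun Y : GaugeSlice S T E3 => cplxVec (ιA S T Y)) := by
    have h := (((ιAc S T).restrictScalars ℝ).comp (cplxSliceL S T)).contDiff (n := ((2 : ℕ) : WithTop ℕ∞))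
    have hfun : (fun Y : GaugeSlice S T E3 => cplxVec (ιA S T Y)) =
        fun Y => ((ιAc S T).restrictScalars ℝ) (cplxSliceL S T Y) := by
      funext Y
      rw [ContinuousLinearMap.coe_restrictScalars', cplxSliceL_apply, ιAc_cplxSlice]
    rw [hfun]
    exact h
  have hgC : ContDiff ℝ ((2 : ℕ) : WithTop ℕ∞) g := contDiff_const.prodMk hg2
  -- the value at the base: `U₀⋆ · Ũ(0) = 1` bondwise
  have hA0 : ∀ b, star ((U₀ b : SU2) : Matrix (Fin 2) (Fin 2) ℂ) * Ũ (g 0) b = 1 := fun b => by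
    have hg0' : g 0 = (cplxVec (0 : VecField P k E3), cplxVec (0 : VecField P k E3)) := by
      simp only [hgdef, map_zero]
    rw [hg0', hU₀eq b]
    exact Matrix.mem_unitaryGroup_iff'.1 (U₀ b).prop.1
  -- regularity, bond by bond
  have hMb : ∀ b, ContDiffAt ℝ ((2 : ℕ) : WithTop ℕ∞) (fun Y => star ((U₀ b : SU2) : Matrix (Fin 2) (Fin 2) ℂ) * Ũ (g Y) b) 0 :=
      fun b => by
    have h1 : ContDiffOn ℂ ((2 : ℕ) : WithTop ℕ∞) (fun z => Ũ z b) (ball 0 R) := contDiffOn_matrix_of_entries isOpen_ball (hdiff b) 2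
    have h2 : ContDiffAt ℂ ((2 : ℕ) : WithTop ℕ∞) (fun z => star ((U₀ b : SU2) : Matrix (Fin 2) (Fin 2) ℂ) * Ũ z b) 0 :=
      contDiffAt_const.mul (h1.contDiffAt (isOpen_ball.mem_nhds (mem_ball_self hR)))
    have h3 : ContDiffAt ℝ ((2 : ℕ) : WithTop ℕ∞) (fun z => star ((U₀ b : SU2) : Matrix (Fin 2) (Fin 2) ℂ) * Ũ z b) (g 0) := by
      rw [hg0]; exact h2.restrict_scalars ℝ
    exact h3.comp 0 hgC.contDiffAt
  have hLb : ∀ b, ContDiffAt ℝ ((2 : ℕ) : WithTop ℕ∞)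
      (fun Y => logCoordC (star ((U₀ b : SU2) : Matrix (Fin 2) (Fin 2) ℂ) * Ũ (g Y) b)) 0 := fun b => by
    have h3 : ContDiffAt ℝ ((2 : ℕ) : WithTop ℕ∞) logCoordC (star ((U₀ b : SU2) : Matrix (Fin 2) (Fin 2) ℂ) * Ũ (g 0) b) := by
      rw [hA0 b]
      exact (contDiffAt_logCoordC (A := 1) (by simp) 2).restrict_scalars ℝ
    have h4 := h3.comp 0 (hMb b)
    exact h4
  have hXb : ∀ b, ContDiffAt ℝ ((2 : ℕ) : WithTop ℕ∞) (fun Y => φ (WithLp.toLp 2 fun a =>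
      (logCoordC (star ((U₀ b : SU2) : Matrix (Fin 2) (Fin 2) ℂ) * Ũ (g Y) b) a).re)) 0 := fun b => by
    have h5 := (contDiff_reVec (n := ((2 : ℕ) : WithTop ℕ∞))).contDiffAt.comp 0 (hLb b)
    have h6 := (LinearMap.toContinuousLinearMap φ).contDiff (n := ((2 : ℕ) : WithTop ℕ∞)) |>.contDiffAt.comp 0 h5
    exact h6
  -- eventual smallness of `U₀⋆ · Ũ(0, ιA Y) − 1` and of `ιA Y`
  have hsmall : ∀ᶠ Y in 𝓝 (0 : GaugeSlice S T E3), ∀ b, ‖star ((U₀ b : SU2) : Matrix (Fin 2) (Fin 2) ℂ) * Ũ (g Y) b - 1‖ ≤ 1 / 3 := by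
    refine eventually_all.2 fun b => ?_
    have hc : ContinuousAt (fun Y => star ((U₀ b : SU2) : Matrix (Fin 2) (Fin 2) ℂ) * Ũ (g Y) b) 0 := (hMb b).continuousAt
    have ht : Tendsto (fun Y => ‖star ((U₀ b : SU2) : Matrix (Fin 2) (Fin 2) ℂ) * Ũ (g Y) b - 1‖) (𝓝 0) (𝓝 0) := by
      have h := ((hc.sub (continuousAt_const : ContinuousAt (fun _ : GaugeSlice S T E3 => (1 : Matrix (Fin 2) (Fin 2) ℂ)) 0)).norm).tendsto
      simpa only [Pi.sub_apply, hA0 b, sub_self, norm_zero] using h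
    exact ht.eventually (Iic_mem_nhds (by norm_num : (0 : ℝ) < 1 / 3))
  have hnormR : ∀ᶠ Y in 𝓝 (0 : GaugeSlice S T E3), ‖ιA S T Y‖ < R := by
    filter_upwards [Metric.ball_mem_nhds (0 : GaugeSlice S T E3) hR] with Y hY
    rw [mem_ball_zero_iff] at hY
    exact lt_of_le_of_lt ((pi_norm_le_iff_of_nonneg (norm_nonneg Y)).2 fun b => norm_ιA_apply_le Y b) hY
  subst hXf
  refine ⟨?_, ?_, ?_⟩
  · -- `Xf 0 = 0`
    funext b
    show φ _ = 0
    have hz : (WithLp.toLp 2 fun a => (logCoordC (star ((U₀ b : SU2) : Matrix (Fin 2) (Fin 2) ℂ) *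
        Ũ (cplxVec (0 : VecField P k E3), cplxVec (ιA S T 0)) b) a).re : EuclideanSpace ℝ (Fin 3)) = 0 := by
      have h1 : star ((U₀ b : SU2) : Matrix (Fin 2) (Fin 2) ℂ) * Ũ (cplxVec (0 : VecField P k E3), cplxVec (ιA S T 0)) b = 1 := by
        rw [map_zero, hU₀eq b]
        exact Matrix.mem_unitaryGroup_iff'.1 (U₀ b).prop.1
      rw [h1, logCoordC_one]
      ext a
      simp
    rw [hz, map_zero]
  · -- `C²` at `0`
    have h := contDiffAt_pi.2 fun b => hXb b
    exact_mod_cast h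
  · -- the family of minimisers near `0`
    filter_upwards [hsmall, hnormR] with Y hsY hYR
    obtain ⟨U', hU'eq, hU'min⟩ := hreal 0 (ιA S T Y) h0R hYR
    rw [expMul_zero] at hU'min
    have hchart : expChart U₀ (fun b => φ (WithLp.toLp 2 fun a =>
        (logCoordC (star ((U₀ b : SU2) : Matrix (Fin 2) (Fin 2) ℂ) * Ũ (cplxVec (0 : VecField P k E3), cplxVec (ιA S T Y)) b) a).re)) = U' := by
      funext b
      apply Subtype.ext
      rw [coe_expChart, hU'eq b]
      have hA : ‖star ((U₀ b : SU2) : Matrix (Fin 2) (Fin 2) ℂ) * ((U' b : SU2) : Matrix (Fin 2) (Fin 2) ℂ) - 1‖ ≤ 1 / 3 := by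
        have h := hsY b
        rwa [show g Y = (cplxVec (0 : VecField P k E3), cplxVec (ιA S T Y)) from rfl, hU'eq b] at h
      exact coe_mul_exp_logChart_eq φ hφ (U₀ b) (U' b) hA
    rw [hchart]
    exact hU'min

end Explicit

end Literature.MathematicalPhysics.QuantumFieldTheory.Balaban1983to89.B15Prop1RealChartFamilyExplicit

end
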